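import Literature.NumberTheory.LFunctions.LittlewoodZeroGapsOrdinates
import Literature.NumberTheory.LFunctions.LittlewoodZeroGapsQuantitative
import HarnessLib

/-!
# Littlewood's theorem on zero gaps — corollaries for the counting function and the enumeration

Trunk T-ANT (`Literature/NumberTheory/LFunctions`).  Two consumer-facing forms of Titchmarsh, *The Theory of the Riemann
Zeta-Function*, 2nd ed., Thms 9.11 / 9.12 (Littlewood 1924), from `LittlewoodZeroGapsProofs.lean` / `…Ordinates.lean` /
`…Quantitative.lean`:

* `zetaZeroCount_sub_lt_zetaZeroCount_add` — for every `δ > 0` and all large `T`: `N(T − δ) < N(T + δ)` (every window of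
  fixed width eventually contains a zero ordinate, counting-function form of Thm 9.11);
* `zetaOrdinate_succ_sub_le_div_logloglog` — for all large `n`: `γ_{n+1} − γ_n ≤ 336 / log log log γ_n` (Thm 9.12 in the
  form `γ_{n+1} − γ_n < A / log log log γ_n`, with the immaterial constant `A = 336`).

Sorry-free, standard axioms; no instances, no notation.  Provenance: cell rh-split, seat rh-split-typer-2 g4.
-/

noncomputable section

open Filter Topology

namespace Literature.NumberTheory.LFunctions

open LittlewoodZeroGaps

/-- **Thm 9.11, counting-function form:** for every `δ > 0`, `N(T − δ) < N(T + δ)` for all large `T`.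
[cite: Titchmarsh1986, Thm 9.11] -/
theorem zetaZeroCount_sub_lt_zetaZeroCount_add (δ : ℝ) (hδ : 0 < δ) :
    ∃ T₁ : ℝ, ∀ T : ℝ, T₁ ≤ T → zetaZeroCount (T - δ) < zetaZeroCount (T + δ) := by
  obtain ⟨T₁, hT₁⟩ := exists_zero_im_near (δ / 2) (by positivity)
  refine ⟨max T₁ δ, fun T hT ↦ ?_⟩
  obtain ⟨ρ, h0, him, -, -⟩ := hT₁ T ((le_max_left _ _).trans hT)
  have hδT : δ ≤ T := (le_max_right _ _).trans hT
  have h1 := abs_le.1 him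
  have hlo : T - δ < ρ.im := by linarith [h1.1]
  have hhi : ρ.im ≤ T + δ := by linarith [h1.2]
  have him0 : 0 < ρ.im := by linarith
  have := zetaZeroCount_add_one_le_of_zero h0 him0 hlo hhi
  omega

/-- `log log log` is positive and monotone from `16` on: `16 ≤ x ≤ y ⟹ 0 < log log log x ≤ log log log y`. [folklore] -/
private theorem logloglog_pos_mono {x y : ℝ} (hx : 16 ≤ x) (hxy : x ≤ y) :
    0 < Real.log (Real.log (Real.log x)) ∧
      Real.log (Real.log (Real.log x)) ≤ Real.log (Real.log (Real.log y)) := by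
  have hx0 : 0 < x := by linarith
  -- `log 16 = 4 log 2 > e`, so `log log 16 > 1` and `log log log 16 > 0`
  have h16 : Real.exp 1 < Real.log 16 := by
    have h2 : Real.log 16 = 4 * Real.log 2 := by
      rw [show (16 : ℝ) = 2 ^ 4 by norm_num, Real.log_pow]; push_cast; ring
    rw [h2]; linarith [Real.log_two_gt_d9, Real.exp_one_lt_d9]
  have hl1 : Real.exp 1 < Real.log x := h16.trans_le (Real.log_le_log (by norm_num) hx)
  have hl1pos : 0 < Real.log x := (Real.exp_pos 1).trans hl1
  have hl2 : 1 < Real.log (Real.log x) := by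
    rw [Real.lt_log_iff_exp_lt hl1pos]; exact hl1
  have hl2pos : 0 < Real.log (Real.log x) := one_pos.trans hl2
  have hl3 : 0 < Real.log (Real.log (Real.log x)) := Real.log_pos hl2
  refine ⟨hl3, ?_⟩
  have hy1 : Real.log x ≤ Real.log y := Real.log_le_log hx0 hxy
  have hy2 : Real.log (Real.log x) ≤ Real.log (Real.log y) := Real.log_le_log hl1pos hy1
  exact Real.log_le_log hl2pos hy2

/-- **Thm 9.12 over the enumeration:** `γ_{n+1} − γ_n ≤ 336 / log log log γ_n` for all large `n` (Titchmarsh's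
`γ_{n+1} − γ_n < A / log log log γ_n`). [cite: Titchmarsh1986, Thm 9.12] -/
theorem zetaOrdinate_succ_sub_le_div_logloglog :
    ∃ N : ℕ, ∀ n : ℕ, N ≤ n →
      zetaOrdinate (n + 1) - zetaOrdinate n ≤ 336 / Real.log (Real.log (Real.log (zetaOrdinate n))) := by
  obtain ⟨T₀, hT₀⟩ := exists_zero_im_near_logloglog
  obtain ⟨N, hN⟩ := eventually_atTop.1 (tendsto_zetaOrdinate_atTop.eventually_ge_atTop (max T₀ 16))
  refine ⟨N, fun n hn ↦ ?_⟩
  have hγ : max T₀ 16 ≤ zetaOrdinate n := hN n hn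
  have hγT : T₀ ≤ zetaOrdinate n := (le_max_left _ _).trans hγ
  have hγ16 : 16 ≤ zetaOrdinate n := (le_max_right _ _).trans hγ
  -- the radius at `γ_n` and the test height `T = γ_n + 2r`
  obtain ⟨r, hrdef⟩ : ∃ r : ℝ, r = 112 / Real.log (Real.log (Real.log (zetaOrdinate n))) := ⟨_, rfl⟩
  have hL3 := (logloglog_pos_mono hγ16 le_rfl).1
  have hr0 : 0 < r := by rw [hrdef]; positivity
  obtain ⟨ρ, h0, him, -, -⟩ := hT₀ (zetaOrdinate n + 2 * r) (by linarith)
  -- the radius at `T` is at most the radius at `γ_n`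
  obtain ⟨hL3T0, hmono⟩ := logloglog_pos_mono hγ16 (by linarith : zetaOrdinate n ≤ zetaOrdinate n + 2 * r)
  have hrad : 112 / Real.log (Real.log (Real.log (zetaOrdinate n + 2 * r))) ≤ r :=
    calc 112 / Real.log (Real.log (Real.log (zetaOrdinate n + 2 * r)))
        ≤ 112 / Real.log (Real.log (Real.log (zetaOrdinate n))) := div_le_div_of_nonneg_left (by norm_num) hL3 hmono
      _ = r := hrdef.symm
  have h1 := abs_le.1 (him.trans hrad)
  have hlo : zetaOrdinate n < ρ.im := by linarith [h1.1]
  have hhi : ρ.im ≤ zetaOrdinate n + 3 * r := by linarith [h1.2]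
  have him0 : 0 < ρ.im := by linarith
  -- counting as in `zetaOrdinate_succ_sub_le`
  have hcount : n + 1 ≤ zetaZeroCount (zetaOrdinate n) :=
    riemann_von_mangoldt_holds.zetaOrdinate_le_iff.1 le_rfl
  have hcount' : n + 1 + 1 ≤ zetaZeroCount (zetaOrdinate n + 3 * r) :=
    le_trans (by omega) (zetaZeroCount_add_one_le_of_zero h0 him0 hlo hhi)
  have hle : zetaOrdinate (n + 1) ≤ zetaOrdinate n + 3 * r :=
    riemann_von_mangoldt_holds.zetaOrdinate_le_iff.2 hcount'
  have h3r : 3 * r = 336 / Real.log (Real.log (Real.log (zetaOrdinate n))) := by rw [hrdef]; ring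
  linarith

end Literature.NumberTheory.LFunctions

end
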